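import Summits.Ventures.CertifiedManyBodySolver.Observables.SingletPairQuadratureLid
import Summits.Ventures.CertifiedManyBodySolver.Observables.LocalPairCeilingTL
import Literature.MathematicalPhysics.QuantumLattice.InfVolFermionStateBounds
import HarnessLib

/-!
# The kinematic LID of the `d`-wave local pair amplitude: `|Re ω(P₀^d)| ≤ √2` for EVERY state

HONEST FRAMING: a certificate-free OPERATOR INEQUALITY (every state of every Hamiltonian, every volume);
it bounds the ONE-POINT d-wave pair amplitude `Re ω(P₀^d)` — the observable of the cell's response floors
and ceilings — by `√2 = 1.4142136` (7 dp UP) and says nothing about order, a field, `h → 0`, `T_c` or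
superconductivity. Cell hubbard-cq (rung CQ; row «h-chord transport nodes», seat hubbard-cq-obsth-2 g23,
2026-08-29), executing the lead's RULING 428 (C) OFFER («`(√2 : ℂ) • 1 − (P + Pᴴ)/2` PosSemidef for
`P = localPair dWaveFormFactor L x`, `L ≥ 3`, via `P = √2·B` on the two-mode Fock space; once landed,
"vacuous above √2" is by name») on top of the two-mode sum of squares of `SingletPairQuadratureLid.lean`
(anomaly-1 g32's certificate `hubbard-pc-lens-anomaly-1/g32/kin/SQRT2-LID-CERT.md`); companion of
`LocalPairCeiling.lean` (`P† P ≤ 4`, Cauchy–Schwarz constant `2`).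

## Results

* torus, `L ≥ 3`: `SingletPair.posSemidef_smul_one_sub_localPair_dWave_add_conjTranspose` (and `_add_`):
  `2√2 · 1 ∓ (P_x + P_xᴴ)` is positive semidefinite for `P_x = localPair dWaveFormFactor L x`
  (`ν = Σ_{unitSteps} g_d(e)²/2 = 2`); general `localPairOn S g` (`0 ∉ S`) with constant
  `2√((Σ_{e ∈ S} g(e)²)/2)`; `SingletPair.abs_re_expect_localPair_dWave_le`: `|Re ⟨ψ, P_x ψ⟩| ≤ √2 · ⟨ψ, ψ⟩`.
* infinite lattice `ℤ²`: `SingletPair.posSemidef_smul_one_sub_localPairAt_add_conjTranspose` (and `_add_`)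
  for `localPairAt S g x` whenever the on-site weight vanishes (`0 ∈ S → g 0 = 0`); and for EVERY infinite-volume state `ω`
  (`InfVolFermionState 2`, positivity + normalisation on the five-site local algebra):
  **`SingletPair.abs_re_infVolExpect_localPairAt_dWave_le_sqrt_two`**
  `|Re ω(localPairAt ({0} ∪ unitSteps) g_d 0)| ≤ √2`, with the 7-dp-UP words
  `SingletPair.re_infVolExpect_localPairAt_dWave_le_decimal : Re ω(P₀^d) ≤ 1.4142136` and
  `SingletPair.neg_decimal_le_re_infVolExpect_localPairAt_dWave : −1.4142136 ≤ Re ω(P₀^d)`.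

SHARP (not proved here): `√2` is attained by a state of the five-site cluster (anomaly-1 g32 RESULT #4,
[float] numerical radius); compare the Cauchy–Schwarz constant `2` of `LocalPairCeiling`. USE (RULING 428
(B)): a booked response-ceiling word `W ≥ 1.4142136` is implied by kinematics for every state — a true
theorem carrying no information as a cell. No definition; no named fact; no `sorry`.
References: D. J. Scalapino, Phys. Rep. 250 (1995) 329, §2 eq. (2.2)–(2.4); O. Bratteli, D. W. Robinson,
*Operator Algebras and Quantum Statistical Mechanics* I, Def. 2.3.9 (states) and II, §5.2.2 (CAR);
folklore otherwise.
-/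

namespace Summit.Ventures.CertifiedManyBodySolver.Observables

open Matrix Literature.MathematicalPhysics.QuantumLattice Literature.Probability.LatticeModels
open scoped ComplexOrder ComplexConjugate

namespace SingletPair

/-! ### §3 Local singlet pairs on the torus -/

section Torus

variable (L : ℕ) [NeZero L]

/-- `Σ_e ‖(g e/√2 : ℂ)‖² = (Σ_e g(e)²)/2`. [folklore] -/
theorem sum_norm_sq_ofReal_div_sqrt_two {E : Type*} (S : Finset E) (g : E → ℝ) :
    ∑ e ∈ S, ‖((g e / Real.sqrt 2 : ℝ) : ℂ)‖ ^ 2 = (∑ e ∈ S, g e ^ 2) / 2 := by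
  rw [Finset.sum_div]
  refine Finset.sum_congr rfl fun e _ => ?_
  rw [Complex.norm_real, Real.norm_eq_abs, sq_abs, div_pow, Real.sq_sqrt zero_le_two]

/-- **Quadrature LID for `localPairOn` (upper side).** If `0 ∉ S` and the steps `{0} ∪ S` have distinct
projections to the torus of side `L`, then `P_x + P_xᴴ ≤ 2√((Σ_{e ∈ S} g(e)²)/2) · 1` for
`P_x = localPairOn S g L x`. Scalapino, Phys. Rep. 250 (1995) 329, §2. [folklore] -/
theorem posSemidef_smul_one_sub_localPairOn_add_conjTranspose (S : Finset (Site 2)) (g : Site 2 → ℝ)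
    (h0 : (0 : Site 2) ∉ S)
    (hS : Set.InjOn (Torus.proj L) ((insert (0 : Site 2) S : Finset (Site 2)) : Set (Site 2)))
    (x : TorusSite 2 L) :
    ((((2 : ℝ) * Real.sqrt ((∑ e ∈ S, g e ^ 2) / 2) : ℝ) : ℂ) •
        (1 : Matrix (Finset (Orb (FermionTorus 2 L))) (Finset (Orb (FermionTorus 2 L))) ℂ) -
      (localPairOn S g L x + (localPairOn S g L x)ᴴ)).PosSemidef := by
  have hv : Set.InjOn (fun e : Site 2 => FermionTorus.ofTorusSite (x + Torus.proj L e)) S := by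
    intro e he e' he' h
    have h' := congrArg FermionTorus.toTorusSite h
    simp only [FermionTorus.toTorusSite_ofTorusSite, add_right_inj] at h'
    exact hS (Finset.mem_coe.2 (Finset.mem_insert_of_mem he))
      (Finset.mem_coe.2 (Finset.mem_insert_of_mem he')) h'
  have hx : ∀ e ∈ S, FermionTorus.ofTorusSite (x + Torus.proj L e) ≠ FermionTorus.ofTorusSite x := by
    intro e he h
    have h' := congrArg FermionTorus.toTorusSite h
    simp only [FermionTorus.toTorusSite_ofTorusSite, add_eq_left] at h'
    have h0' : Torus.proj L e = Torus.proj L 0 := by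
      rw [h']; funext i; simp [Torus.proj_apply]
    exact h0 ((hS (Finset.mem_coe.2 (Finset.mem_insert_of_mem he))
      (Finset.mem_coe.2 (Finset.mem_insert_self 0 S)) h0') ▸ he)
  have h := posSemidef_smul_one_sub_sitePair_add_conjTranspose S (fun e => ((g e / Real.sqrt 2 : ℝ) : ℂ))
    (fun e => FermionTorus.ofTorusSite (x + Torus.proj L e)) (FermionTorus.ofTorusSite x) hv hx
  rw [sum_norm_sq_ofReal_div_sqrt_two] at h
  rw [localPairOn_eq_sitePair]
  -- `convert` reconciles the `DecidableEq` instances hidden in `(1 : Matrix _ _ ℂ)`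
  convert h

/-- **Quadrature LID for `localPairOn` (lower side)**: `−(P_x + P_xᴴ) ≤ 2√((Σ_{e ∈ S} g(e)²)/2) · 1`.
Scalapino, Phys. Rep. 250 (1995) 329, §2. [folklore] -/
theorem posSemidef_smul_one_add_localPairOn_add_conjTranspose (S : Finset (Site 2)) (g : Site 2 → ℝ)
    (h0 : (0 : Site 2) ∉ S)
    (hS : Set.InjOn (Torus.proj L) ((insert (0 : Site 2) S : Finset (Site 2)) : Set (Site 2)))
    (x : TorusSite 2 L) :
    ((((2 : ℝ) * Real.sqrt ((∑ e ∈ S, g e ^ 2) / 2) : ℝ) : ℂ) •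
        (1 : Matrix (Finset (Orb (FermionTorus 2 L))) (Finset (Orb (FermionTorus 2 L))) ℂ) +
      (localPairOn S g L x + (localPairOn S g L x)ᴴ)).PosSemidef := by
  have hv : Set.InjOn (fun e : Site 2 => FermionTorus.ofTorusSite (x + Torus.proj L e)) S := by
    intro e he e' he' h
    have h' := congrArg FermionTorus.toTorusSite h
    simp only [FermionTorus.toTorusSite_ofTorusSite, add_right_inj] at h'
    exact hS (Finset.mem_coe.2 (Finset.mem_insert_of_mem he))
      (Finset.mem_coe.2 (Finset.mem_insert_of_mem he')) h'
  have hx : ∀ e ∈ S, FermionTorus.ofTorusSite (x + Torus.proj L e) ≠ FermionTorus.ofTorusSite x := by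
    intro e he h
    have h' := congrArg FermionTorus.toTorusSite h
    simp only [FermionTorus.toTorusSite_ofTorusSite, add_eq_left] at h'
    have h0' : Torus.proj L e = Torus.proj L 0 := by
      rw [h']; funext i; simp [Torus.proj_apply]
    exact h0 ((hS (Finset.mem_coe.2 (Finset.mem_insert_of_mem he))
      (Finset.mem_coe.2 (Finset.mem_insert_self 0 S)) h0') ▸ he)
  have h := posSemidef_smul_one_add_sitePair_add_conjTranspose S (fun e => ((g e / Real.sqrt 2 : ℝ) : ℂ))
    (fun e => FermionTorus.ofTorusSite (x + Torus.proj L e)) (FermionTorus.ofTorusSite x) hv hx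
  rw [sum_norm_sq_ofReal_div_sqrt_two] at h
  rw [localPairOn_eq_sitePair]
  convert h

/-- **The kinematic LID of the `d_{x²-y²}` local pair (upper side): `P_x + P_xᴴ ≤ 2√2 · 1`** on every
torus of side `L ≥ 3` (`Σ_{unitSteps} g_d(e)²/2 = 2`; an operator inequality on Fock space — every state,
every Hamiltonian). Scalapino, Phys. Rep. 250 (1995) 329, §2 eq. (2.2)–(2.4). [folklore] -/
theorem posSemidef_smul_one_sub_localPair_dWave_add_conjTranspose (hL : 3 ≤ L) (x : TorusSite 2 L) :
    ((((2 : ℝ) * Real.sqrt 2 : ℝ) : ℂ) •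
        (1 : Matrix (Finset (Orb (FermionTorus 2 L))) (Finset (Orb (FermionTorus 2 L))) ℂ) -
      (localPair dWaveFormFactor L x + (localPair dWaveFormFactor L x)ᴴ)).PosSemidef := by
  have h := posSemidef_smul_one_sub_localPairOn_add_conjTranspose L unitSteps dWaveFormFactor
    (by decide) (PairFieldYang.torusProj_injOn_insert_zero_unitSteps hL) x
  rw [sum_unitSteps_sq_dWaveFormFactor, ← localPair_dWave_eq_localPairOn_unitSteps] at h
  convert h using 4
  norm_num

/-- **The kinematic LID of the `d_{x²-y²}` local pair (lower side): `−(P_x + P_xᴴ) ≤ 2√2 · 1`**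
(`L ≥ 3`). Scalapino, Phys. Rep. 250 (1995) 329, §2 eq. (2.2)–(2.4). [folklore] -/
theorem posSemidef_smul_one_add_localPair_dWave_add_conjTranspose (hL : 3 ≤ L) (x : TorusSite 2 L) :
    ((((2 : ℝ) * Real.sqrt 2 : ℝ) : ℂ) •
        (1 : Matrix (Finset (Orb (FermionTorus 2 L))) (Finset (Orb (FermionTorus 2 L))) ℂ) +
      (localPair dWaveFormFactor L x + (localPair dWaveFormFactor L x)ᴴ)).PosSemidef := by
  have h := posSemidef_smul_one_add_localPairOn_add_conjTranspose L unitSteps dWaveFormFactor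
    (by decide) (PairFieldYang.torusProj_injOn_insert_zero_unitSteps hL) x
  rw [sum_unitSteps_sq_dWaveFormFactor, ← localPair_dWave_eq_localPairOn_unitSteps] at h
  convert h using 4
  norm_num

/-- From `C·1 ∓ (A + Aᴴ)` positive semidefinite: `|Re ⟨ψ, A ψ⟩| ≤ (C/2)·⟨ψ, ψ⟩` — here packaged as the
two one-sided real inequalities `±2 Re ⟨ψ, A ψ⟩ ≤ C · Re ⟨ψ, ψ⟩`. [folklore] -/
theorem two_mul_re_expect_le_of_posSemidef {ι : Type*} [Fintype ι] [DecidableEq ι] (C : ℝ)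
    (A : Matrix (Finset ι) (Finset ι) ℂ) (ψ : Fock ι)
    (h : (((C : ℝ) : ℂ) • (1 : Matrix (Finset ι) (Finset ι) ℂ) - (A + Aᴴ)).PosSemidef) :
    2 * (expect A ψ).re ≤ C * (star ψ ⬝ᵥ ψ).re := by
  have hA : (star ψ ⬝ᵥ (Aᴴ *ᵥ ψ)).re = (star ψ ⬝ᵥ (A *ᵥ ψ)).re := by
    rw [star_dotProduct ψ (Aᴴ *ᵥ ψ), star_mulVec, conjTranspose_conjTranspose, ← dotProduct_mulVec,
      Complex.star_def, Complex.conj_re]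
  have h1 := h.dotProduct_mulVec_nonneg ψ
  rw [Matrix.sub_mulVec, dotProduct_sub, Matrix.smul_mulVec, Matrix.one_mulVec, dotProduct_smul,
    Matrix.add_mulVec, dotProduct_add, sub_nonneg, Complex.le_def] at h1
  have h2 := h1.1
  rw [Complex.add_re, hA, smul_eq_mul, Complex.mul_re, Complex.ofReal_re, Complex.ofReal_im, zero_mul,
    sub_zero] at h2
  simp only [expect]
  linarith

/-- Mirror of `two_mul_re_expect_le_of_posSemidef`: from `C·1 + (A + Aᴴ)` positive semidefinite,
`−2 Re ⟨ψ, A ψ⟩ ≤ C · Re ⟨ψ, ψ⟩`. [folklore] -/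
theorem neg_two_mul_re_expect_le_of_posSemidef {ι : Type*} [Fintype ι] [DecidableEq ι] (C : ℝ)
    (A : Matrix (Finset ι) (Finset ι) ℂ) (ψ : Fock ι)
    (h : (((C : ℝ) : ℂ) • (1 : Matrix (Finset ι) (Finset ι) ℂ) + (A + Aᴴ)).PosSemidef) :
    -(2 * (expect A ψ).re) ≤ C * (star ψ ⬝ᵥ ψ).re := by
  have hA : (star ψ ⬝ᵥ (Aᴴ *ᵥ ψ)).re = (star ψ ⬝ᵥ (A *ᵥ ψ)).re := by
    rw [star_dotProduct ψ (Aᴴ *ᵥ ψ), star_mulVec, conjTranspose_conjTranspose, ← dotProduct_mulVec,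
      Complex.star_def, Complex.conj_re]
  have h1 := h.dotProduct_mulVec_nonneg ψ
  rw [Matrix.add_mulVec, dotProduct_add, Matrix.smul_mulVec, Matrix.one_mulVec, dotProduct_smul,
    Matrix.add_mulVec, dotProduct_add, Complex.le_def] at h1
  have h2 := h1.1
  rw [Complex.zero_re, Complex.add_re, Complex.add_re, hA, smul_eq_mul, Complex.mul_re, Complex.ofReal_re,
    Complex.ofReal_im, zero_mul, sub_zero] at h2
  simp only [expect]
  linarith

/-- **`|Re ⟨ψ, P_x ψ⟩| ≤ √2 · ⟨ψ, ψ⟩`** for the `d_{x²-y²}` local pair on every torus of side `L ≥ 3` and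
every vector `ψ` (for a normalised state: `|Re ⟨P_x⟩| ≤ √2 = 1.41421…`; compare the Cauchy–Schwarz constant
`2` from `P_x† P_x ≤ 4`). Scalapino, Phys. Rep. 250 (1995) 329, §2. [folklore] -/
theorem abs_re_expect_localPair_dWave_le (hL : 3 ≤ L) (x : TorusSite 2 L)
    (ψ : Fock (Orb (FermionTorus 2 L))) :
    |(expect (localPair dWaveFormFactor L x) ψ).re| ≤ Real.sqrt 2 * (star ψ ⬝ᵥ ψ).re := by
  have h1 := two_mul_re_expect_le_of_posSemidef ((2 : ℝ) * Real.sqrt 2) _ ψ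
    (posSemidef_smul_one_sub_localPair_dWave_add_conjTranspose L hL x)
  have h2 := neg_two_mul_re_expect_le_of_posSemidef ((2 : ℝ) * Real.sqrt 2) _ ψ
    (posSemidef_smul_one_add_localPair_dWave_add_conjTranspose L hL x)
  rw [abs_le]
  constructor <;> linarith

end Torus

/-! ### §4 The local pair of the infinite lattice `ℤ²` and infinite-volume states -/

section Lattice

/-- **Quadrature LID of the local pair of `ℤ²` (upper side)**: for a step set `S`, a form factor `g` whose
on-site weight vanishes when `0 ∈ S`, and a site `x`, `P_x + P_xᴴ ≤ 2√((Σ_{e ∈ S} g(e)²)/2) · 1` in the local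
algebra of `pairRegion S x`, `P_x = localPairAt S g x` (on `ℤ²` the shifted sites `x + e`, `e ≠ 0`, are
automatically distinct from `x` and from each other — no torus-size hypothesis; same reduction as
`posSemidef_smul_one_sub_localPairAt`). Scalapino, Phys. Rep. 250 (1995) 329, §2. [folklore] -/
theorem posSemidef_smul_one_sub_localPairAt_add_conjTranspose (S : Finset (Site 2)) (g : Site 2 → ℝ)
    (x : Site 2) (hg : (0 : Site 2) ∈ S → g 0 = 0) :
    ((((2 : ℝ) * Real.sqrt ((∑ e ∈ S, g e ^ 2) / 2) : ℝ) : ℂ) • (1 : FermionOp (pairRegion S x)) -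
      (localPairAt S g x + (localPairAt S g x)ᴴ)).PosSemidef := by
  classical
  set c : S → ℂ := fun e => ((g e.1 / Real.sqrt 2 : ℝ) : ℂ) with hc
  set v : S → PolySite (pairRegion S x) := fun e => PolySite.pt (x + e.1) (add_mem_pairRegion x e.2)
    with hv
  set E : Finset S := S.attach.filter fun e => e.1 ≠ 0 with hE
  have hc0 : ∀ e : S, e.1 = 0 → c e = 0 := by
    intro e he
    have : g e.1 = 0 := by rw [he]; exact hg (he ▸ e.2)
    simp [hc, this]
  have hsum : ∀ σ : Fin 2,
      ∑ e ∈ S.attach, c e • annihilation (orb (v e) σ) = ∑ e ∈ E, c e • annihilation (orb (v e) σ) := by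
    intro σ
    rw [hE, Finset.sum_filter_of_ne]
    intro e _ hne
    by_contra h0
    exact hne (by rw [hc0 e h0, zero_smul])
  have hinj : Set.InjOn v E := by
    intro e _ e' _ h
    have h' := congrArg (fun p : PolySite (pairRegion S x) => ofLex p.1) h
    simp only [hv, PolySite.ofLex_coe_pt, add_right_inj] at h'
    exact Subtype.ext h'
  have hoff : ∀ e ∈ E, v e ≠ PolySite.pt x (self_mem_pairRegion S x) := by
    intro e he h
    have h' := congrArg (fun p : PolySite (pairRegion S x) => ofLex p.1) h
    simp only [hv, PolySite.ofLex_coe_pt, add_eq_left] at h'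
    exact (Finset.mem_filter.1 he).2 h'
  have hconst : ∑ e ∈ E, ‖c e‖ ^ 2 = (∑ e ∈ S, g e ^ 2) / 2 := by
    rw [hc, sum_norm_sq_ofReal_div_sqrt_two, hE, Finset.sum_filter_of_ne,
      Finset.sum_attach S fun e => g e ^ 2]
    intro e _ hne h0
    exact hne (by rw [h0, hg (h0 ▸ e.2), zero_pow two_ne_zero])
  have h := posSemidef_smul_one_sub_sitePair_add_conjTranspose E c v
    (PolySite.pt x (self_mem_pairRegion S x)) hinj hoff
  rw [hconst, ← hsum 0, ← hsum 1] at h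
  rw [localPairAt_eq_sitePair]
  convert h

/-- **Quadrature LID of the local pair of `ℤ²` (lower side)**: `−(P_x + P_xᴴ) ≤ 2√((Σ_{e ∈ S} g(e)²)/2) · 1`.
Scalapino, Phys. Rep. 250 (1995) 329, §2. [folklore] -/
theorem posSemidef_smul_one_add_localPairAt_add_conjTranspose (S : Finset (Site 2)) (g : Site 2 → ℝ)
    (x : Site 2) (hg : (0 : Site 2) ∈ S → g 0 = 0) :
    ((((2 : ℝ) * Real.sqrt ((∑ e ∈ S, g e ^ 2) / 2) : ℝ) : ℂ) • (1 : FermionOp (pairRegion S x)) +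
      (localPairAt S g x + (localPairAt S g x)ᴴ)).PosSemidef := by
  classical
  set c : S → ℂ := fun e => ((g e.1 / Real.sqrt 2 : ℝ) : ℂ) with hc
  set v : S → PolySite (pairRegion S x) := fun e => PolySite.pt (x + e.1) (add_mem_pairRegion x e.2)
    with hv
  set E : Finset S := S.attach.filter fun e => e.1 ≠ 0 with hE
  have hc0 : ∀ e : S, e.1 = 0 → c e = 0 := by
    intro e he
    have : g e.1 = 0 := by rw [he]; exact hg (he ▸ e.2)
    simp [hc, this]
  have hsum : ∀ σ : Fin 2,
      ∑ e ∈ S.attach, c e • annihilation (orb (v e) σ) = ∑ e ∈ E, c e • annihilation (orb (v e) σ) := by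
    intro σ
    rw [hE, Finset.sum_filter_of_ne]
    intro e _ hne
    by_contra h0
    exact hne (by rw [hc0 e h0, zero_smul])
  have hinj : Set.InjOn v E := by
    intro e _ e' _ h
    have h' := congrArg (fun p : PolySite (pairRegion S x) => ofLex p.1) h
    simp only [hv, PolySite.ofLex_coe_pt, add_right_inj] at h'
    exact Subtype.ext h'
  have hoff : ∀ e ∈ E, v e ≠ PolySite.pt x (self_mem_pairRegion S x) := by
    intro e he h
    have h' := congrArg (fun p : PolySite (pairRegion S x) => ofLex p.1) h
    simp only [hv, PolySite.ofLex_coe_pt, add_eq_left] at h'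
    exact (Finset.mem_filter.1 he).2 h'
  have hconst : ∑ e ∈ E, ‖c e‖ ^ 2 = (∑ e ∈ S, g e ^ 2) / 2 := by
    rw [hc, sum_norm_sq_ofReal_div_sqrt_two, hE, Finset.sum_filter_of_ne,
      Finset.sum_attach S fun e => g e ^ 2]
    intro e _ hne h0
    exact hne (by rw [h0, hg (h0 ▸ e.2), zero_pow two_ne_zero])
  have h := posSemidef_smul_one_add_sitePair_add_conjTranspose E c v
    (PolySite.pt x (self_mem_pairRegion S x)) hinj hoff
  rw [hconst, ← hsum 0, ← hsum 1] at h
  rw [localPairAt_eq_sitePair]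
  convert h

/-- **The kinematic LID of the `d`-wave pair amplitude in EVERY infinite-volume state**: for every state
`ω` of the CAR algebra of `ℤ²` (`InfVolFermionState 2`), `|Re ω(P₀^d)| ≤ √2` for
`P₀^d = localPairAt ({0} ∪ unitSteps) g_d 0` — the observable of the cell's response floors / ceilings.
Certificate-free kinematics (positivity + normalisation of `ω` on the five-site local algebra); silent
on order. Scalapino, Phys. Rep. 250 (1995) 329, §2; Bratteli–Robinson I, Def. 2.3.9. [folklore] -/
theorem abs_re_infVolExpect_localPairAt_dWave_le_sqrt_two (ω : InfVolFermionState 2) :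
    |(ω.expect (pairRegion (insert (0 : Site 2) unitSteps) 0)
        (localPairAt (insert 0 unitSteps) dWaveFormFactor 0)).re| ≤ Real.sqrt 2 := by
  set Λ₀ : Finset (Site 2) := pairRegion (insert (0 : Site 2) unitSteps) 0
  set P : FermionOp Λ₀ := localPairAt (insert 0 unitSteps) dWaveFormFactor 0
  have hC : (((2 : ℝ) * Real.sqrt ((∑ e ∈ insert (0 : Site 2) unitSteps, dWaveFormFactor e ^ 2) / 2) : ℝ) : ℂ) =
      (((2 : ℝ) * Real.sqrt 2 : ℝ) : ℂ) := by
    rw [PairFieldYang.sum_sq_dWaveFormFactor]; norm_num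
  have hre : (ω.expect Λ₀ Pᴴ).re = (ω.expect Λ₀ P).re := by
    rw [ω.expect_conjTranspose, Complex.star_def, Complex.conj_re]
  have h₁ := ω.expect_re_nonneg_of_posSemidef Λ₀
    (posSemidef_smul_one_sub_localPairAt_add_conjTranspose (insert 0 unitSteps) dWaveFormFactor 0
      fun _ => dWaveFormFactor_zero)
  have h₂ := ω.expect_re_nonneg_of_posSemidef Λ₀
    (posSemidef_smul_one_add_localPairAt_add_conjTranspose (insert 0 unitSteps) dWaveFormFactor 0
      fun _ => dWaveFormFactor_zero)
  rw [hC, map_sub, map_smul, ω.expect_one, map_add, Complex.sub_re, Complex.add_re, hre, smul_eq_mul,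
    mul_one, Complex.ofReal_re] at h₁
  rw [hC, map_add, map_smul, ω.expect_one, map_add, Complex.add_re, Complex.add_re, hre, smul_eq_mul,
    mul_one, Complex.ofReal_re] at h₂
  rw [abs_le]
  constructor <;> linarith

/-- `√2 < 1.4142136`. [folklore] -/
theorem sqrt_two_lt_14142136 : Real.sqrt 2 < (14142136 / 10 ^ 7 : ℝ) := by
  rw [Real.sqrt_lt' (by norm_num)]; norm_num

/-- **The √2-lid as a 7-dp-UP word: `Re ω(P₀^d) ≤ 1.4142136` for EVERY infinite-volume state `ω`**
(RULING 428: a booked response-ceiling cell `W ≥ 1.4142136` is implied by kinematics — a true theorem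
carrying no information). Silent on order. Scalapino, Phys. Rep. 250 (1995) 329, §2. [folklore] -/
theorem re_infVolExpect_localPairAt_dWave_le_decimal (ω : InfVolFermionState 2) :
    (ω.expect (pairRegion (insert (0 : Site 2) unitSteps) 0)
        (localPairAt (insert 0 unitSteps) dWaveFormFactor 0)).re ≤ (14142136 / 10000000 : ℝ) := by
  have h := (abs_le.1 (abs_re_infVolExpect_localPairAt_dWave_le_sqrt_two ω)).2
  have h2 := sqrt_two_lt_14142136
  norm_num at h2 ⊢
  linarith

/-- Mirror word: **`−1.4142136 ≤ Re ω(P₀^d)`** for every infinite-volume state `ω`. Silent on order.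
Scalapino, Phys. Rep. 250 (1995) 329, §2. [folklore] -/
theorem neg_decimal_le_re_infVolExpect_localPairAt_dWave (ω : InfVolFermionState 2) :
    -(14142136 / 10000000 : ℝ) ≤ (ω.expect (pairRegion (insert (0 : Site 2) unitSteps) 0)
        (localPairAt (insert 0 unitSteps) dWaveFormFactor 0)).re := by
  have h := (abs_le.1 (abs_re_infVolExpect_localPairAt_dWave_le_sqrt_two ω)).1
  have h2 := sqrt_two_lt_14142136
  norm_num at h2 ⊢
  linarith

end Lattice

end SingletPair

end Summit.Ventures.CertifiedManyBodySolver.Observables
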